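import Summits.KontsevichZagierPeriods.KontsevichZagierPeriods.Theorems.OctahedralSymmetryOctahedralSpanAllWeightsStubRegularE0Front
import HarnessLib

/-!
# Block F1 of the crux `OctahedralSpanAllWeights` (stmt-KontsevichZagierPeriods-9659), line `Sketch`: depth two and glue

Helper file 3/3 for the stub `stub_regular_e0` (block F1), namespace `…OctaSpan.RegularE0`.

1. **Depth two, all weights** (`depthTwo`, `stub_regular_e0_depthTwo`): the layer-`m` words of depth
   two, `X(a, c₁, c₂) = 4^a c₁ 4^{m-a} c₂` (`0 ≤ a ≤ m`, `c₁, c₂ ∈ {1,2,3}`; the values `Li_{a+1,m-a+1}` at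
   poles `≠ 1`), reduce modulo `rel` to convergent `e₁`-free words with fewer letters `4`, for every
   `m ≥ 1`. Family (M) `relM`: the finite double shuffle of the depth-two index
   `4^a (c₁/β) 4^{m-1-a} (c₂/β)` with the letter `β ∉ {1, c₁, c₂}` — merged terms `X(a+1, c₁, c₂)` and
   `X(a, c₁/β, c₂)`, the three inserted terms and the shuffle have `m - 1` letters `4`; with family (U)
   (`relU`) these become equations between the classes `y2` (`y2_familyM`, `y2_familyU`), eliminated by
   `depthTwo_core`.
2. **Glue.** `regular_e0_of_headFourCore`: strong induction on the length with `frontReduce`.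
   `regular_e0_of_core` (registered helper stub): **the registered stub's exact statement follows from
   the RESIDUAL CORE** `∀ n, (F1 below length n) → ∀ W, |W| = n → W.head? = some 4 → W convergent →
   #0(W) = 0 → #4(W) + 3 ≤ |W| → sym W ∈ rel ⊔ e0Lower W` (the `4`-initial words of depth `≥ 3`), the
   depth-one and depth-two layers being `stub_regular_e0_top` and `stub_regular_e0_depthTwo`. The core is
   open for general `n` (a genuine piece of the all-weights span conjecture; true for `n ≤ 5` by exact
   linear algebra in the line's lab) and is the recommended replacement stub.

References: J. Zhao, Doc. Math. 15 (2010), §2 Def. 2.4, (FDS), Lemma 2.2, §5 [Zhao2010]; J. Zhao,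
C. R. Acad. Sci. Paris 346 (2008), §4 [Zhao2008]; M. E. Hoffman, J. Algebra 194 (1997), §2 [Hoffman1997].
-/

noncomputable section

namespace Summit.KontsevichZagierPeriods.OctahedralSymmetry.OctaSpan.RegularE0

open Literature.NumberTheory.Transcendental Literature.NumberTheory.Transcendental.LevelFour

/-- **Family (M) of the depth-two block.** For letters encoded by `l₁, l₂, lb ∈ (ℤ/4)∖{0}` (poles
`i^{l₁}, i^{l₂}, i^{lb}`) with `l₁ + lb, l₂ + lb ≠ 0`, the finite double shuffle of the index
`((a+1, -l₁), (b+1, l₁-l₂))` (word `4^a [l₁] 4^b [l₂]`) with `((1, -lb))` gives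
`[4^{a+1} [l₁+lb] 4^b [l₂+lb]] + [4^a [l₁] 4^{b+1} [l₂+lb]] ∈ rel ⊔ (words with ≤ a+b letters 4)`.
[cite: Zhao2010, §2 (FDS)] -/
theorem relM (a b : ℕ) (l₁ l₂ lb : Fin 4) (h₁ : l₁ ≠ 0) (h₂ : l₂ ≠ 0) (hb : lb ≠ 0)
    (h₁b : l₁ + lb ≠ 0) (h₂b : l₂ + lb ≠ 0) :
    sym (List.replicate (a + 1) 4 ++ Fin.castSucc (l₁ + lb) ::
        (List.replicate b 4 ++ [Fin.castSucc (l₂ + lb)])) +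
      sym (List.replicate a 4 ++ Fin.castSucc l₁ ::
        (List.replicate (b + 1) 4 ++ [Fin.castSucc (l₂ + lb)])) ∈
      rel ⊔ e0Lower (List.replicate (a + 1) 4 ++ Fin.castSucc (l₁ + lb) ::
        (List.replicate b 4 ++ [Fin.castSucc (l₂ + lb)])) := by
  have hcs0 : ∀ x : Fin 4, x ≠ 0 → Fin.castSucc x ≠ (0 : Fin 5) := by decide
  have hcs4 : ∀ x : Fin 4, Fin.castSucc x ≠ (4 : Fin 5) := by decide
  have hpos : ∀ p ∈ ([] : List (ℕ × Fin 4)), 1 ≤ p.1 := by simp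
  -- the indices
  have hk : IsConvergentIdx [(a + 1, -l₁), (b + 1, l₁ - l₂)] :=
    isConvergentIdx_cons (by omega) (fun _ => neg_ne_zero.2 h₁) (by simp)
  have hq : IsConvergentIdx [(1, -lb)] := isConvergentIdx_cons le_rfl (fun _ => neg_ne_zero.2 hb) hpos
  have hI0 : IsConvergentIdx [(1, -lb), (a + 1, -l₁), (b + 1, l₁ - l₂)] :=
    isConvergentIdx_cons le_rfl (fun _ => neg_ne_zero.2 hb) (by simp)
  have hI1 : IsConvergentIdx [(a + 1, -l₁), (1, -lb), (b + 1, l₁ - l₂)] :=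
    isConvergentIdx_cons (by omega) (fun _ => neg_ne_zero.2 h₁) (by simp)
  have hI2 : IsConvergentIdx [(a + 1, -l₁), (b + 1, l₁ - l₂), (1, -lb)] :=
    isConvergentIdx_cons (by omega) (fun _ => neg_ne_zero.2 h₁) (by simp)
  have hgen : fdsGen [(a + 1, -l₁), (b + 1, l₁ - l₂)] [(1, -lb)] ∈ rel :=
    mem_rel_of_isGen (IsGen.fds hk hq)
  -- letters
  set A := Fin.castSucc l₁ with hA
  set B := Fin.castSucc l₂ with hB
  set C := Fin.castSucc lb with hC
  set D := Fin.castSucc (l₁ + lb) with hD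
  set E := Fin.castSucc (l₂ + lb) with hE
  have hA0 : A ≠ 0 := hcs0 _ h₁
  have hB0 : B ≠ 0 := hcs0 _ h₂
  have hC0 : C ≠ 0 := hcs0 _ hb
  have hD0 : D ≠ 0 := hcs0 _ h₁b
  have hE0 : E ≠ 0 := hcs0 _ h₂b
  have hA4 : A ≠ 4 := hcs4 _
  have hB4 : B ≠ 4 := hcs4 _
  have hC4 : C ≠ 4 := hcs4 _
  have hD4 : D ≠ 4 := hcs4 _
  have hE4 : E ≠ 4 := hcs4 _
  -- the words
  have hst : stuffleIdx [(a + 1, -l₁), (b + 1, l₁ - l₂)] [(1, -lb)] =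
      [[(a + 1, -l₁), (b + 1, l₁ - l₂), (1, -lb)], [(a + 1, -l₁), (1, -lb), (b + 1, l₁ - l₂)],
        [(a + 1, -l₁), (b + 1 + 1, l₁ - l₂ + -lb)], [(1, -lb), (a + 1, -l₁), (b + 1, l₁ - l₂)],
        [(a + 1 + 1, -l₁ + -lb), (b + 1, l₁ - l₂)]] := rfl
  have hwk : word [(a + 1, -l₁), (b + 1, l₁ - l₂)] =
      List.replicate a 4 ++ A :: (List.replicate b 4 ++ [B]) := by
    simp [word, wordAux, hA, hB]
  have hwq : word [(1, -lb)] = [C] := by simp [word, wordAux, hC]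
  have hwI2 : word [(a + 1, -l₁), (b + 1, l₁ - l₂), (1, -lb)] =
      List.replicate a 4 ++ A :: (List.replicate b 4 ++ [B, E]) := by
    simp [word, wordAux, hA, hB, hE]; abel
  have hwI1 : word [(a + 1, -l₁), (1, -lb), (b + 1, l₁ - l₂)] =
      List.replicate a 4 ++ A :: D :: (List.replicate b 4 ++ [E]) := by
    simp [word, wordAux, hA, hD, hE]; abel
  have hwM2 : word [(a + 1, -l₁), (b + 1 + 1, l₁ - l₂ + -lb)] =
      List.replicate a 4 ++ A :: (List.replicate (b + 1) 4 ++ [E]) := by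
    simp [word, wordAux, hA, hE]; abel
  have hwI0 : word [(1, -lb), (a + 1, -l₁), (b + 1, l₁ - l₂)] =
      C :: (List.replicate a 4 ++ D :: (List.replicate b 4 ++ [E])) := by
    simp [word, wordAux, hC, hD, hE]; abel
  have hwM1 : word [(a + 1 + 1, -l₁ + -lb), (b + 1, l₁ - l₂)] =
      List.replicate (a + 1) 4 ++ D :: (List.replicate b 4 ++ [E]) := by
    simp [word, wordAux, hD, hE]; abel
  -- the finite double shuffle, expanded
  have hfds : fdsGen [(a + 1, -l₁), (b + 1, l₁ - l₂)] [(1, -lb)] =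
      sym (word [(a + 1, -l₁), (b + 1, l₁ - l₂), (1, -lb)]) +
        sym (word [(a + 1, -l₁), (1, -lb), (b + 1, l₁ - l₂)]) -
        sym (List.replicate a 4 ++ A :: (List.replicate (b + 1) 4 ++ [E])) +
        sym (word [(1, -lb), (a + 1, -l₁), (b + 1, l₁ - l₂)]) -
        sym (List.replicate (a + 1) 4 ++ D :: (List.replicate b 4 ++ [E])) -
        toQ (shuffle (word [(a + 1, -l₁), (b + 1, l₁ - l₂)]) (word [(1, -lb)])) := by
    simp only [fdsGen, stuffleSigned, hst, List.map_cons, List.map_nil, List.length_cons,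
      List.length_nil, hwM1, hwM2, ofTerms_cons, ofTerms_nil, map_add, map_zero, toQ_single]
    norm_num
    abel
  -- common numerics of the target word
  have hlen : (List.replicate (a + 1) 4 ++ D :: (List.replicate b 4 ++ [E])).length = a + b + 3 := by
    simp; omega
  have hcnt : (List.replicate (a + 1) 4 ++ D :: (List.replicate b 4 ++ [E])).count 4 = a + b + 1 := by
    simp [hD4, hE4]; omega
  -- the four lower terms
  have hT2 : sym (word [(a + 1, -l₁), (b + 1, l₁ - l₂), (1, -lb)]) ∈
      e0Lower (List.replicate (a + 1) 4 ++ D :: (List.replicate b 4 ++ [E])) := by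
    refine sym_mem_e0Lower ?_ (isConvergent_word hI2) ?_ ?_
    · rw [hwI2, hlen]; simp; omega
    · rw [hwI2]; simp [List.count_replicate, hA0, hB0, hE0]
    · rw [hwI2, hcnt]; simp [hA4, hB4, hE4]
  have hT1 : sym (word [(a + 1, -l₁), (1, -lb), (b + 1, l₁ - l₂)]) ∈
      e0Lower (List.replicate (a + 1) 4 ++ D :: (List.replicate b 4 ++ [E])) := by
    refine sym_mem_e0Lower ?_ (isConvergent_word hI1) ?_ ?_
    · rw [hwI1, hlen]; simp; omega
    · rw [hwI1]; simp [List.count_replicate, hA0, hD0, hE0]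
    · rw [hwI1, hcnt]; simp [hA4, hD4, hE4]
  have hT0 : sym (word [(1, -lb), (a + 1, -l₁), (b + 1, l₁ - l₂)]) ∈
      e0Lower (List.replicate (a + 1) 4 ++ D :: (List.replicate b 4 ++ [E])) := by
    refine sym_mem_e0Lower ?_ (isConvergent_word hI0) ?_ ?_
    · rw [hwI0, hlen]; simp; omega
    · rw [hwI0]; simp [List.count_replicate, hC0, hD0, hE0]
    · rw [hwI0, hcnt]; simp [hC4, hD4, hE4]
  have hT3 : toQ (shuffle (word [(a + 1, -l₁), (b + 1, l₁ - l₂)]) (word [(1, -lb)])) ∈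
      e0Lower (List.replicate (a + 1) 4 ++ D :: (List.replicate b 4 ++ [E])) := by
    refine toQ_shuffle_mem _ _ _ fun w hw => ?_
    have hp := MZV.perm_of_mem_shuffleWord _ _ hw
    refine sym_mem_e0Lower ?_ ?_ ?_ ?_
    · rw [hp.length_eq, hlen, hwk, hwq]; simp; omega
    · exact isConvergent_of_mem_shuffleWord (isConvergent_word hk) (isConvergent_word hq) hw
    · rw [hp.count_eq, hwk, hwq]; simp [List.count_replicate, hA0, hB0, hC0]
    · rw [hp.count_eq, hcnt, hwk, hwq]; simp [hA4, hB4, hC4]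
  -- assemble
  rw [Submodule.mem_sup]
  refine ⟨-fdsGen [(a + 1, -l₁), (b + 1, l₁ - l₂)] [(1, -lb)], rel.neg_mem hgen, _,
    Submodule.sub_mem _ (Submodule.add_mem _ (Submodule.add_mem _ hT2 hT1) hT0) hT3, ?_⟩
  rw [hfds]
  abel

/-- **Family (M) for the unknowns**: the twelve merge relations per level `a < m`. [folklore] -/
theorem y2_familyM (m a : ℕ) (ha : a < m) :
    (y2 m (a + 1) 1 1 = -y2 m a 3 1 ∧ y2 m (a + 1) 1 1 = -y2 m a 2 1 ∧
      y2 m (a + 1) 2 1 = -y2 m a 3 1 ∧ y2 m (a + 1) 3 1 = -y2 m a 1 1) ∧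
    (y2 m (a + 1) 2 2 = -y2 m a 1 2 ∧ y2 m (a + 1) 2 2 = -y2 m a 3 2 ∧
      y2 m (a + 1) 1 2 = -y2 m a 2 2 ∧ y2 m (a + 1) 3 2 = -y2 m a 2 2) ∧
    (y2 m (a + 1) 3 3 = -y2 m a 2 3 ∧ y2 m (a + 1) 3 3 = -y2 m a 1 3 ∧
      y2 m (a + 1) 1 3 = -y2 m a 3 3 ∧ y2 m (a + 1) 2 3 = -y2 m a 1 3) := by
  have cs1 : Fin.castSucc (1 : Fin 4) = (1 : Fin 5) := by decide
  have cs2 : Fin.castSucc (2 : Fin 4) = (2 : Fin 5) := by decide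
  have cs3 : Fin.castSucc (3 : Fin 4) = (3 : Fin 5) := by decide
  have a32 : (3 : Fin 4) + 2 = 1 := by decide
  have a23 : (2 : Fin 4) + 3 = 1 := by decide
  have a33 : (3 : Fin 4) + 3 = 2 := by decide
  have a12 : (1 : Fin 4) + 2 = 3 := by decide
  have a11 : (1 : Fin 4) + 1 = 2 := by decide
  have a21 : (2 : Fin 4) + 1 = 3 := by decide
  have e1 : m - 1 - a + 1 = m - a := by omega
  have e2 : m - 1 - a = m - (a + 1) := by omega
  have one : (1 : Fin 5) = 1 ∨ (1 : Fin 5) = 2 ∨ (1 : Fin 5) = 3 := Or.inl rfl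
  have two : (2 : Fin 5) = 1 ∨ (2 : Fin 5) = 2 ∨ (2 : Fin 5) = 3 := Or.inr (Or.inl rfl)
  have three : (3 : Fin 5) = 1 ∨ (3 : Fin 5) = 2 ∨ (3 : Fin 5) = 3 := Or.inr (Or.inr rfl)
  have inst : ∀ (l₁ l₂ lb : Fin 4), l₁ ≠ 0 → l₂ ≠ 0 → lb ≠ 0 → l₁ + lb ≠ 0 → l₂ + lb ≠ 0 →
      sym (X2 m (a + 1) (Fin.castSucc (l₁ + lb)) (Fin.castSucc (l₂ + lb))) +
        sym (X2 m a (Fin.castSucc l₁) (Fin.castSucc (l₂ + lb))) ∈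
      rel ⊔ e0Lower (X2 m (a + 1) (Fin.castSucc (l₁ + lb)) (Fin.castSucc (l₂ + lb))) := by
    intro l₁ l₂ lb h₁ h₂ hb h₁b h₂b
    have h := relM a (m - 1 - a) l₁ l₂ lb h₁ h₂ hb h₁b h₂b
    rw [e1, e2] at h
    exact h
  refine ⟨⟨?_, ?_, ?_, ?_⟩, ⟨?_, ?_, ?_, ?_⟩, ⟨?_, ?_, ?_, ?_⟩⟩
  · have h := inst 3 3 2 (by decide) (by decide) (by decide) (by decide) (by decide)
    simp only [a32, cs1, cs3] at h
    exact y2_eq_neg (by omega) one one h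
  · have h := inst 2 2 3 (by decide) (by decide) (by decide) (by decide) (by decide)
    simp only [a23, cs1, cs2] at h
    exact y2_eq_neg (by omega) one one h
  · have h := inst 3 2 3 (by decide) (by decide) (by decide) (by decide) (by decide)
    simp only [a33, a23, cs1, cs2, cs3] at h
    exact y2_eq_neg (by omega) two one h
  · have h := inst 1 3 2 (by decide) (by decide) (by decide) (by decide) (by decide)
    simp only [a12, a32, cs1, cs3] at h
    exact y2_eq_neg (by omega) three one h
  · have h := inst 1 1 1 (by decide) (by decide) (by decide) (by decide) (by decide)
    simp only [a11, cs1, cs2] at h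
    exact y2_eq_neg (by omega) two two h
  · have h := inst 3 3 3 (by decide) (by decide) (by decide) (by decide) (by decide)
    simp only [a33, cs2, cs3] at h
    exact y2_eq_neg (by omega) two two h
  · have h := inst 2 3 3 (by decide) (by decide) (by decide) (by decide) (by decide)
    simp only [a23, a33, cs1, cs2] at h
    exact y2_eq_neg (by omega) one two h
  · have h := inst 2 1 1 (by decide) (by decide) (by decide) (by decide) (by decide)
    simp only [a21, a11, cs2, cs3] at h
    exact y2_eq_neg (by omega) three two h
  · have h := inst 2 2 1 (by decide) (by decide) (by decide) (by decide) (by decide)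
    simp only [a21, cs2, cs3] at h
    exact y2_eq_neg (by omega) three three h
  · have h := inst 1 1 2 (by decide) (by decide) (by decide) (by decide) (by decide)
    simp only [a12, cs1, cs3] at h
    exact y2_eq_neg (by omega) three three h
  · have h := inst 3 1 2 (by decide) (by decide) (by decide) (by decide) (by decide)
    simp only [a32, a12, cs1, cs3] at h
    exact y2_eq_neg (by omega) one three h
  · have h := inst 1 2 1 (by decide) (by decide) (by decide) (by decide) (by decide)
    simp only [a11, a21, cs1, cs2, cs3] at h
    exact y2_eq_neg (by omega) two three h

/-- **Family (U) for the unknowns**: `∑_{j ≤ m} y(j, c, d) + y(m, d, c) = 0`. [folklore] -/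
theorem y2_familyU (m : ℕ) (hm : 1 ≤ m) (c d : Fin 5) (hc : c ∈ [(1 : Fin 5), 2, 3])
    (hd : d ∈ [(1 : Fin 5), 2, 3]) :
    ∑ j ∈ Finset.range (m + 1), y2 m j c d + y2 m m d c = 0 := by
  have hc' : c = 1 ∨ c = 2 ∨ c = 3 := by simpa using hc
  have hd' : d = 1 ∨ d = 2 ∨ d = 3 := by simpa using hd
  have h := relU m hm c d hc' hd'
  have hX : List.replicate m 4 ++ [d, c] = X2 m m d c := by simp [X2]
  rw [hX, e0Lower_X2 le_rfl hd' hc'] at h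
  have h0 : (T2 m).mkQ ((∑ j ∈ Finset.range (m + 1),
      sym (List.replicate j 4 ++ c :: (List.replicate (m - j) 4 ++ [d]))) + sym (X2 m m d c)) = 0 :=
    (Submodule.Quotient.mk_eq_zero (T2 m)).2 h
  rw [map_add, map_sum] at h0
  exact h0

/-- **The depth-two block of F1, all weights `m + 2 ≥ 3`.** Every word `4^a c₁ 4^{m-a} c₂` with unit
letters `c₁, c₂ ∈ {1, 2, 3}` (the `e₁`-free convergent words with exactly two unit letters, i.e. the
level-4 values `Li_{a+1, m-a+1}` at poles `≠ 1`) reduces modulo `rel` to convergent `e₁`-free words of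
the same length with fewer letters `4`: families (M) (`relM`) and (U) (`relU`) and the elimination
`depthTwo_core`. [folklore] -/
theorem depthTwo (m : ℕ) (hm : 1 ≤ m) (a : ℕ) (ha : a ≤ m) (c₁ c₂ : Fin 5)
    (hc₁ : c₁ = 1 ∨ c₁ = 2 ∨ c₁ = 3) (hc₂ : c₂ = 1 ∨ c₂ = 2 ∨ c₂ = 3) :
    sym (List.replicate a 4 ++ c₁ :: (List.replicate (m - a) 4 ++ [c₂])) ∈
      rel ⊔ e0Lower (List.replicate a 4 ++ c₁ :: (List.replicate (m - a) 4 ++ [c₂])) := by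
  have hM := fun a' (ha' : a' < m) => y2_familyM m a' ha'
  have core := depthTwo_core (1 : Fin 5) 2 3 m hm (y2 m)
    (fun a' h => (hM a' h).1.1) (fun a' h => (hM a' h).1.2.1) (fun a' h => (hM a' h).1.2.2.1)
    (fun a' h => (hM a' h).1.2.2.2) (fun a' h => (hM a' h).2.1.1) (fun a' h => (hM a' h).2.1.2.1)
    (fun a' h => (hM a' h).2.1.2.2.1) (fun a' h => (hM a' h).2.1.2.2.2) (fun a' h => (hM a' h).2.2.1)
    (fun a' h => (hM a' h).2.2.2.1) (fun a' h => (hM a' h).2.2.2.2.1) (fun a' h => (hM a' h).2.2.2.2.2)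
    (fun c d hc hd => y2_familyU m hm c d hc hd)
  have hy : y2 m a c₁ c₂ = 0 := core a ha c₁ c₂ (by simpa using hc₁) (by simpa using hc₂)
  have hT : sym (X2 m a c₁ c₂) ∈ T2 m := (Submodule.Quotient.mk_eq_zero _).1 hy
  rw [T2, ← e0Lower_X2 ha hc₁ hc₂] at hT
  exact hT

/-! ## Glue -/

/-- **Block F1 for the words with exactly two unit letters, all weights** (the stub's statement under the
extra hypothesis `#4 + 2 = length`, i.e. depth two). [folklore] -/
theorem stub_regular_e0_depthTwo (W : List (Fin 5)) (hW : IsConvergent W) (h0 : W.count 0 = 0)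
    (h4pos : 0 < W.count 4) (h4 : W.count 4 + 2 = W.length) :
    sym W ∈ rel ⊔ Submodule.span ℚ (sym '' {V | V.length = W.length ∧ IsConvergent V ∧
      V.count 0 = 0 ∧ V.count 4 < W.count 4}) := by
  have key : ∀ c : Fin 5, c ≠ 4 → c ≠ 0 → (c = 1 ∨ c = 2 ∨ c = 3) := by decide
  -- `W = W' ++ [c₂]`
  obtain ⟨W', c₂, rfl⟩ : ∃ W' c, W = W' ++ [c] := by
    cases W using List.reverseRecOn with
    | nil => simp at h4
    | append_singleton W' c => exact ⟨W', c, rfl⟩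
  have hc₂4 : c₂ ≠ 4 := fun h => hW.2 (by simp [h])
  have hc₂0 : c₂ ≠ 0 := fun h => by
    have : (0 : Fin 5) ∈ W' ++ [c₂] := by simp [h]
    exact (List.count_pos_iff.2 this).ne' h0
  have hc₂ := key c₂ hc₂4 hc₂0
  -- `W' = 4^a c₁ rest`, `rest = 4^b`
  have hW'cnt : W'.count 4 + 1 = W'.length := by
    simp only [List.count_append, List.count_singleton', List.length_append,
      List.length_singleton] at h4
    rw [if_neg hc₂4] at h4
    omega
  set u := W'.takeWhile fun x => x = 4 with hu_def
  have hsplit : W' = u ++ W'.dropWhile fun x => x = 4 := (List.takeWhile_append_dropWhile).symm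
  have hD : (W'.dropWhile fun x => x = 4) ≠ [] := by
    rw [Ne, List.dropWhile_eq_nil_iff]
    intro h
    have hall : W'.count 4 = W'.length :=
      List.count_eq_length.2 fun b hb => by simpa [eq_comm] using h b hb
    omega
  obtain ⟨c₁, rest, hrest⟩ : ∃ c₁ rest, (W'.dropWhile fun x => x = 4) = c₁ :: rest :=
    List.exists_cons_of_ne_nil hD
  have hc₁4 : c₁ ≠ 4 := by
    have hhead := List.head_dropWhile_not (fun x : Fin 5 => decide (x = 4)) hD
    simp only [hrest, List.head_cons] at hhead
    simpa using hhead
  rw [hrest] at hsplit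
  have hu : u = List.replicate u.length 4 :=
    List.eq_replicate_iff.2 ⟨rfl, fun b hb => by simpa using List.mem_takeWhile_imp hb⟩
  have hc₁0 : c₁ ≠ 0 := fun h => by
    have : (0 : Fin 5) ∈ W' ++ [c₂] := by rw [hsplit, h]; simp
    exact (List.count_pos_iff.2 this).ne' h0
  have hc₁ := key c₁ hc₁4 hc₁0
  have hrest4 : rest = List.replicate rest.length 4 := by
    have hcnt : W'.count 4 = u.length + rest.count 4 := by
      conv_lhs => rw [hsplit, hu]
      simp [hc₁4]
    have hlenW' : W'.length = u.length + rest.length + 1 := by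
      conv_lhs => rw [hsplit]
      simp; omega
    have hr : rest.count 4 = rest.length := by omega
    exact List.eq_replicate_iff.2 ⟨rfl, fun b hb => ((List.count_eq_length.1 hr) b hb).symm⟩
  -- conclude with `depthTwo`
  set a := u.length
  set b := rest.length
  have hWeq : W' ++ [c₂] = List.replicate a 4 ++ c₁ :: (List.replicate ((a + b) - a) 4 ++ [c₂]) := by
    rw [hsplit, hu, hrest4, Nat.add_sub_cancel_left]
    simp [a, b]
  have hm : 1 ≤ a + b := by
    have h1 : (W' ++ [c₂]).count 4 = a + b := by
      rw [hWeq, Nat.add_sub_cancel_left]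
      simp [hc₁4, hc₂4]
    omega
  have h := depthTwo (a + b) hm a (Nat.le_add_right a b) c₁ c₂ hc₁ hc₂
  rw [← hWeq] at h
  exact h

/-- **Glue (all weights): the residual core implies block F1.** The RESIDUAL CORE of block F1
(recommended replacement stub) is the hypothesis `hcore`: the words of length `n` that BEGIN with the
pole `0` (letter `4`), are `e₁`-free and convergent, reduce — given block F1 for all shorter words. It is
open for general `n` (true for `n ≤ 5` by exact linear algebra in the line's lab) and is what is left
after `depthOne`, `frontReduce`, `depthTwo`. The glue is strong induction on the length with the front
reduction `frontReduce`. [folklore] -/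
theorem regular_e0_of_headFourCore
    (hcore : ∀ n : ℕ, (∀ W : List (Fin 5), W.length < n → IsConvergent W → W.count 0 = 0 →
        0 < W.count 4 → sym W ∈ rel ⊔ e0Lower W) →
      ∀ W : List (Fin 5), W.length = n → W.head? = some 4 → IsConvergent W → W.count 0 = 0 →
        sym W ∈ rel ⊔ e0Lower W)
    (W : List (Fin 5)) (hW : IsConvergent W) (h0 : W.count 0 = 0) (h4 : 0 < W.count 4) :
    sym W ∈ rel ⊔ e0Lower W := by
  suffices key : ∀ n (W : List (Fin 5)), W.length = n → IsConvergent W → W.count 0 = 0 →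
      0 < W.count 4 → sym W ∈ rel ⊔ e0Lower W from key _ W rfl hW h0 h4
  intro n
  induction n using Nat.strong_induction_on with
  | _ n ihn =>
  intro W hn hW h0 h4
  exact frontReduce (fun W' hlt hW' h0' h4' => ihn _ hlt W' rfl hW' h0' h4') (hcore n
    fun W' hlt hW' h0' h4' => ihn _ hlt W' rfl hW' h0' h4') W hn hW h0 h4

/-- A convergent nonempty word has fewer letters `4` than letters. [folklore] -/
theorem count_four_lt_length {W : List (Fin 5)} (hW : IsConvergent W) (hne : W ≠ []) :
    W.count 4 < W.length := by
  obtain ⟨W', c, rfl⟩ : ∃ W' c, W = W' ++ [c] := by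
    cases W using List.reverseRecOn with
    | nil => exact (hne rfl).elim
    | append_singleton W' c => exact ⟨W', c, rfl⟩
  have hc : c ≠ 4 := fun h => hW.2 (by simp [h])
  simp only [List.count_append, List.count_singleton', if_neg hc, List.length_append,
    List.length_singleton]
  have := List.count_le_length (a := (4 : Fin 5)) (l := W')
  omega

/-- **The registered stub from the residual core.** If the `4`-initial convergent `e₁`-free words of
depth `≥ 3` (`#4 + 3 ≤ |W|`) of each length reduce — given block F1 for all shorter words — then block F1
(`stub_regular_e0` of the skeleton, verbatim) holds for every word: the layers of depth one and two are
`stub_regular_e0_top` and `stub_regular_e0_depthTwo`, the passage to `4`-initial words is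
`regular_e0_of_headFourCore`. [folklore] -/
theorem regular_e0_of_core
    (hcore : ∀ n : ℕ, (∀ W : List (Fin 5), W.length < n → IsConvergent W → W.count 0 = 0 →
        0 < W.count 4 → sym W ∈ rel ⊔ e0Lower W) →
      ∀ W : List (Fin 5), W.length = n → W.head? = some 4 → IsConvergent W → W.count 0 = 0 →
        W.count 4 + 3 ≤ W.length → sym W ∈ rel ⊔ e0Lower W)
    (W : List (Fin 5)) (hW : IsConvergent W) (h0 : W.count 0 = 0) (h4 : 0 < W.count 4) :
    sym W ∈ rel ⊔ Submodule.span ℚ (sym '' {V | V.length = W.length ∧ IsConvergent V ∧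
      V.count 0 = 0 ∧ V.count 4 < W.count 4}) := by
  refine regular_e0_of_headFourCore (fun n ih V hn hhead hV hV0 => ?_) W hW h0 h4
  have hVne : V ≠ [] := by rintro rfl; simp at hhead
  have hV4 : 0 < V.count 4 := List.count_pos_iff.2 (List.mem_of_mem_head? hhead)
  have hlt := count_four_lt_length hV hVne
  by_cases htop : V.count 4 + 1 = V.length
  · exact stub_regular_e0_top V hV hV0 hV4 htop
  by_cases htwo : V.count 4 + 2 = V.length
  · exact stub_regular_e0_depthTwo V hV hV0 hV4 htwo
  exact hcore n ih V hn hhead hV hV0 (by omega)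

end Summit.KontsevichZagierPeriods.OctahedralSymmetry.OctaSpan.RegularE0

end
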